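import Mathlib
import Literature.Topology.FourManifolds.GroupTrisections
import Summits.SmoothPoincare4.SmoothPoincare4.Theses.CongruenceShadows

/-!
# Sketch — crux-ideate `stmt-SmoothPoincare4-14591` (NormalFormStablyTrivial), ideator 2, round 1

First lemmas of the two idea cards, typed over existing declarations
(`Literature.Topology.FourManifolds.GroupTrisections` + the route file `CongruenceShadows`).
Nothing here is proposed to the tree; it only has to elaborate.

* Card `hyperelliptic-descent`: `IsHyperelliptic`, `IsInvariant`, `StablyHyperelliptic` (K1),
  `HyperellipticStablyTrivial` (K2), `HypInsertion` (unstable double-coset probe),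
  `card1_reduction`.
* Card `primitive-reducing-systems`: `ustab` (elementary unbalanced stabilisation of a kernel
  triple), `StablyThreeHandleFree` (K1 = kernel form of "homotopy 4-spheres are geometrically
  simply connected"), `ThreeHandleFreeStablyTrivial` (K2), `BrownLodayRank` (support P1),
  `card2_reduction`.
-/

open Literature.Topology.FourManifolds

noncomputable section

namespace Summit.SmoothPoincare4.SmoothPoincare4.Cruxes.NormalFormStablyTrivial.Sketch

/-- Shorthand: the surface group `S_g`. -/
abbrev S (g : ℕ) : Type := SurfaceGroup g

/-- Shorthand: the stabilised standard `S⁴` triple `N = s4Kernels.stabilizeIter m`, genus `3+3m`. -/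
abbrev N (m : ℕ) : TrisectionKernels (3 + 3 * m) := s4Kernels.stabilizeIter m

/-- The crux's normal-form hypothesis: the three pairs of `K` are each simultaneously standard. -/
def PairStd (m : ℕ) (K : TrisectionKernels (3 + 3 * m)) : Prop :=
  ∀ i j : Fin 3, i ≠ j → ∃ α : S (3 + 3 * m) ≃* S (3 + 3 * m),
    (N m i).map α.toMonoidHom = K i ∧ (N m j).map α.toMonoidHom = K j

/-- `φ` stabilises the subgroup `P` (set-wise). -/
def Stab {g : ℕ} (P : Subgroup (S g)) (φ : S g ≃* S g) : Prop := P.map φ.toMonoidHom = P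

/-- A kernel triple is invariant under an automorphism. -/
def IsInvariant {g : ℕ} (ι : S g ≃* S g) (K : TrisectionKernels g) : Prop :=
  ∀ i, (K i).map ι.toMonoidHom = K i

/-- Algebraic hyperelliptic involution of `S_g`: a non-trivial automorphism of order two acting as
inversion on the abelianisation `H₁(Σ_g)` (for a closed surface this pins the conjugacy class of
the hyperelliptic involution in `Mod^±(Σ_g)`: Lefschetz gives `2g+2` fixed points, the quotient is
`S²`). -/
def IsHyperelliptic {g : ℕ} (ι : S g ≃* S g) : Prop :=
  ι.trans ι = MulEquiv.refl _ ∧ ι ≠ MulEquiv.refl _ ∧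
    ∀ x : S g, Abelianization.of (ι x) = (Abelianization.of x)⁻¹

/-- `z` commutes with `ι` (lies in the hyperelliptic centraliser `Z(ι)`, the Birman–Hilden group). -/
def Centralises {g : ℕ} (ι z : S g ≃* S g) : Prop := z.trans ι = ι.trans z

/-! ### Card 1 — hyperelliptic descent -/

/-- **K1 (stable hyperelliptic symmetrisation).** Every Waldhausen-normalised `(3+3m, m+1)` group
trisection of the trivial group becomes, after finitely many stabilisations, isomorphic to a
kernel triple invariant under a hyperelliptic involution of `S_{3+3m+3n}`. Equivalent (via AGK
realisation + Gay–Kirby stable uniqueness + Meier–Scott 2025 Thm 6.10) to: every homotopy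
4-sphere is a 2-fold branched cover of `S⁴` along a surface-link. -/
def StablyHyperelliptic : Prop :=
  ∀ (m : ℕ) (K : TrisectionKernels (3 + 3 * m)),
    IsGroupTrisection (3 + 3 * m) (m + 1) (PUnit : Type) K → PairStd m K →
    ∃ (n : ℕ) (K' : TrisectionKernels (3 + 3 * m + 3 * n))
      (ι : S (3 + 3 * m + 3 * n) ≃* S (3 + 3 * m + 3 * n)),
      IsHyperelliptic ι ∧ IsInvariant ι K' ∧ TrisectionKernels.Iso (K.stabilizeIter n) K'

/-- **K2 (the crux on the hyperelliptic locus).** A hyperelliptic-invariant group trisection of the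
trivial group is stably trivial — by Birman–Hilden / Meier–Scott this is SPC4 for double branched
covers `Σ₂(S⁴, F)` of bridge-trisected surface-links with `π₁ Σ₂(F) = 1`. -/
def HyperellipticStablyTrivial : Prop :=
  ∀ (g k : ℕ) (K : TrisectionKernels g), IsGroupTrisection g k (PUnit : Type) K →
    (∃ ι : S g ≃* S g, IsHyperelliptic ι ∧ IsInvariant ι K) → K.IsStablyTrivial

/-- **Unstable double-coset probe (genus `3+3m`, cheapest at `m = 0`).** With `A, B, C` the
stabilisers of `N₀, N₁, N₂` and `Z(ι)` the centraliser of a hyperelliptic involution fixing the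
standard triple: every `a ∈ A ∩ B·C` whose triple `(N₀, N₁, a N₂)` is a trisection of `{1}` lies in
`(A ∩ B) · Z(ι) · C`. (The crux itself asks for `(A ∩ B) · C`; inserting `Z(ι)` is the relaxation.)
Composition convention: `a = d ∘ z ∘ c` is `(c.trans z).trans d`. -/
def HypInsertion (m : ℕ) : Prop :=
  ∀ ι : S (3 + 3 * m) ≃* S (3 + 3 * m), IsHyperelliptic ι → IsInvariant ι (N m) →
  ∀ a : S (3 + 3 * m) ≃* S (3 + 3 * m), Stab (N m 0) a →
    (∃ b c : S (3 + 3 * m) ≃* S (3 + 3 * m), Stab (N m 1) b ∧ Stab (N m 2) c ∧ a = c.trans b) →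
    IsGroupTrisection (3 + 3 * m) (m + 1) (PUnit : Type)
      ![N m 0, N m 1, (N m 2).map a.toMonoidHom] →
    ∃ d z c : S (3 + 3 * m) ≃* S (3 + 3 * m),
      Stab (N m 0) d ∧ Stab (N m 1) d ∧ Centralises ι z ∧ Stab (N m 2) c ∧ a = (c.trans z).trans d

/-- Card 1 assembly towards the crux: K1 ∧ K2 ⇒ `NormalFormStablyTrivial` (bookkeeping: transport
`IsGroupTrisection` along stabilisation — `stabilize_isGroupTrisection_holds` — and along `Iso`,
then re-index `IsStablyTrivial` of `K.stabilizeIter n` to `K`). -/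
theorem card1_reduction (h1 : StablyHyperelliptic) (h2 : HyperellipticStablyTrivial) :
    Summit.SmoothPoincare4.SmoothPoincare4.Theses.CongruenceShadows.NormalFormStablyTrivial := by
  sorry

/-! ### Card 2 — primitive reducing systems (Brown–Loday classes and the 1-handle half) -/

/-- The inclusion `S_g`-generators `↦` the first `g` handles of `S_{g+1}`, on free groups. -/
def genIncl1 (g : ℕ) : FreeGroup (surfaceGen g) →* FreeGroup (surfaceGen (g + 1)) :=
  FreeGroup.map fun p => (Fin.castAdd 1 p.1, p.2)

/-- The new longitude `a'` of the added handle of `S_{g+1}`. -/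
def newA (g : ℕ) : S (g + 1) := SurfaceGroup.a (Fin.natAdd g (0 : Fin 1))

/-- The new meridian `b'` of the added handle of `S_{g+1}`. -/
def newB (g : ℕ) : S (g + 1) := SurfaceGroup.b (Fin.natAdd g (0 : Fin 1))

/-- **Elementary (unbalanced) stabilisation** of a kernel triple in direction `j`: the kernel `K_j`
receives the new meridian `b'`, the two other kernels receive the new longitude `a'` (so the pair
of handlebodies other than `H_j` gains a common reducing curve: their union acquires an `S¹×S²`
summand and the sector they bound gains a 1-handle; in handle terms `j` indexes which of the three
cancelling-pair types is born). Three of them, one per `j`, make the balanced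
`TrisectionKernels.stabilize`. -/
def ustab {g : ℕ} (j : Fin 3) (K : TrisectionKernels g) : TrisectionKernels (g + 1) := fun i =>
  Subgroup.normalClosure
    ((PresentedGroup.mk _ ∘ genIncl1 g) '' ((PresentedGroup.mk _) ⁻¹' (K i : Set (S g))) ∪
      {if i = j then newB g else newA g})

/-- Iterated elementary stabilisation in a fixed direction. -/
def ustabIter {g : ℕ} (j : Fin 3) (K : TrisectionKernels g) : (r : ℕ) → TrisectionKernels (g + r)
  | 0 => K
  | r + 1 => ustab j (ustabIter j K r)

/-- **K1 (stably 3-handle-free, kernel form).** After finitely many stabilisations, a normalised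
group trisection of the trivial group is isomorphic to an `(m+1+n)`-fold elementary stabilisation
IN ONE DIRECTION of a triple of genus `2(m+1+n)` — i.e. one sector's `k` can be destabilised to
zero; equivalently (Gay–Kirby handle dictionary) the homotopy 4-sphere has a handle decomposition
without 3-handles, i.e. (dually) is geometrically simply connected. The card's lever: the
destabilising curves are exactly simple primitive representatives of the Brown–Loday classes
`π₂(X ∖ X_j) ≅ (R ∩ R')/[R, R']` in `π₁` of the opposite handlebody. -/
def StablyThreeHandleFree : Prop :=
  ∀ (m : ℕ) (K : TrisectionKernels (3 + 3 * m)),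
    IsGroupTrisection (3 + 3 * m) (m + 1) (PUnit : Type) K → PairStd m K →
    ∃ (n : ℕ) (j : Fin 3) (K'' : TrisectionKernels (2 * (m + 1 + n)))
      (h : 2 * (m + 1 + n) + (m + 1 + n) = 3 + 3 * m + 3 * n),
      TrisectionKernels.Iso (K.stabilizeIter n) ((ustabIter j K'' (m + 1 + n)).cast h)

/-- **K2 (3-handle-free trisections of `{1}` are stably trivial)** = kernel form of "geometrically
simply connected homotopy 4-spheres are `S⁴`" (route NoOneHandles' `NoohGscStandard`). -/
def ThreeHandleFreeStablyTrivial : Prop :=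
  ∀ (r : ℕ) (j : Fin 3) (K'' : TrisectionKernels (2 * r)) (h : 2 * r + r = 3 * r),
    IsGroupTrisection (3 * r) r (PUnit : Type) ((ustabIter j K'' r).cast h) →
    ((ustabIter j K'' r).cast h).IsStablyTrivial

/-- Brown–Loday statement at level `m`, given normality of `K₂`: in `Φ = S/K₂ = π₁(H₂)` (free of rank
`3+3m`) the images `R₀, R₁` of `K₀, K₁` satisfy `(R₀ ∩ R₁)/[R₀, R₁] ≅ ℤ^{m+1}` — this is
`π₂(X_A ∪_{H₂} X_B) = π₂(X ∖ X_C) = H₂(X⁰ ♮ ♮^{m+1} S²×B²)` by Brown–Loday's van Kampen theorem for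
the pushout of `K(F_{m+1},1) ← K(F_{3+3m},1) → K(F_{m+1},1)`. -/
def BLStatement (m : ℕ) (K : TrisectionKernels (3 + 3 * m)) [(K 2).Normal] : Prop :=
  let R₀ : Subgroup (S (3 + 3 * m) ⧸ K 2) := (K 0).map (QuotientGroup.mk' (K 2))
  let R₁ : Subgroup (S (3 + 3 * m) ⧸ K 2) := (K 1).map (QuotientGroup.mk' (K 2))
  ∃ f : ↥(R₀ ⊓ R₁) →* Multiplicative (Fin (m + 1) → ℤ),
    Function.Surjective f ∧ f.ker = (⁅R₀, R₁⁆).subgroupOf (R₀ ⊓ R₁)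

/-- **P1 (support; a theorem of algebraic topology, Brown–Loday 1987).** -/
def BrownLodayRank : Prop :=
  ∀ (m : ℕ) (K : TrisectionKernels (3 + 3 * m))
    (hK : IsGroupTrisection (3 + 3 * m) (m + 1) (PUnit : Type) K), @BLStatement m K (hK.normal 2)

/-- Card 2 assembly towards the crux: K1 ∧ K2 ⇒ `NormalFormStablyTrivial` (transport
`IsGroupTrisection` along stabilisation and `Iso`; re-index `IsStablyTrivial`). -/
theorem card2_reduction (h1 : StablyThreeHandleFree) (h2 : ThreeHandleFreeStablyTrivial) :
    Summit.SmoothPoincare4.SmoothPoincare4.Theses.CongruenceShadows.NormalFormStablyTrivial := by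
  sorry

end Summit.SmoothPoincare4.SmoothPoincare4.Cruxes.NormalFormStablyTrivial.Sketch

end
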